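import Literature.Topology.FourManifolds.CappellShanesonGompfChains
import Literature.Topology.FourManifolds.CappellShanesonClassGroupNineteen
import Literature.Topology.FourManifolds.CappellShanesonClassGroupTwentyone
import Literature.Topology.FourManifolds.CappellShanesonClassGroupThirtysevenMain
import HarnessLib

/-!
# The transpose of a standard Cappell–Shaneson matrix, and the transpose pairs among the open classes of traces 70–78

New elementary mathematics from the bundle `papers/SmoothPoincare4/cappell-shaneson-gompf-chains` (cell
`pub-sp4gompf`, seat 2 generation 3; AI-generated, formally verified in Lean 4, not peer-reviewed by a human),
Remark "What remains open" of the note.  Two things are certified here, in the tree's rendering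
(`standardCSMatrix c d n h = X_{c,d,n} = !![0, a, b; 0, c, d; 1, 0, n - c]`, `a = csEntryA c d n = -fₙ(c)/d`,
`b = (c-1)(n-c-1)`, Kim–Yamada 2023 Def. 2.5 / Prop. 2.10; `IsConj` in `SL(3, ℤ)` = similarity over `ℤ`,
`isConj_iff_exists_isUnit_det`, KY Remark 2.21):

1. **The transposition identity.**  For every standard matrix and every `s` with `s² = 1`,
   `X_{c,d,n}ᵀ P = P X_{c,sa,n}` with the unimodular `P = !![0, 0, 1; 0, s, 0; 1, 0, n - c]` (`det P = -s`);
   here `X_{c,sa,n}` is again standard (`s a ∣ fₙ(c) = -a d`, and its `a`-entry is `s d`).  Hence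
   `X_{c,d,n}ᵀ ∼ X_{c,|a|,n}` (`isConj_transpose_standardCSMatrix`): transposition swaps the roles of `d` and
   `|a|`, i.e. it replaces the ideal `⟨Θₙ - c, d⟩` by the complementary ideal `⟨Θₙ - c, |a|⟩` of the same `c`
   (their product is the principal ideal `(Θₙ - c)` since `d · |a| = |fₙ(c)| = |N(Θₙ - c)|`), in accordance with
   Taussky's theorem that the transpose of a matrix class corresponds to the inverse ideal class
   (O. Taussky, *On matrix classes corresponding to an ideal and its inverse*, Illinois J. Math. 1 (1957) 108–113).
   The identity itself is a one-line matrix computation; we found it stated nowhere in the Cappell–Shaneson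
   literature (Gompf 2010 §3 and Kim–Yamada 2023 Rem. 2.7 only remark that the transpose of a standard form is the
   form used by earlier authors).

2. **The transpose pairs.**  Among the eleven ideal classes of traces `70 ≤ n ≤ 78` whose Gompf equivalence to `A₀`
   is undecided after Iwaki 2025 (minimal representatives `(104,141,70)`, `(37,155,70)`, `(23,145,73)`, `(23,171,73)`,
   `(41,189,73)`, `(31,197,75)`, `(101,163,75)`, `(98,153,76)`, `(116,141,76)`, `(61,253,77)`, `(34,145,77)`),
   ten form five TRANSPOSE PAIRS `X ∼ Yᵀ`, certified below by explicit unimodular intertwiners `W` with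
   `W X' = Xᵀ W` checked by `decide`:
   `(37,155,70) ∼ (104,141,70)ᵀ`, `(23,171,73) ∼ (23,145,73)ᵀ`, `(101,163,75) ∼ (31,197,75)ᵀ`,
   `(116,141,76) ∼ (98,153,76)ᵀ`, `(34,145,77) ∼ (61,253,77)ᵀ`; and the transpose of the eleventh is a SETTLED
   class: `(83,105,73) ∼ (41,189,73)ᵀ` with `73 ≡ -32 (mod 105)`, a trace in Kim–Yamada's range `[-64, 69]`
   — and in the tree UNCONDITIONALLY: `GompfConjectureForTrace (-32)` follows from the tree's theorems for the traces
   `37 = 5 - (-32)`, `-16`, `-14` (`gompfConjectureForTrace_neg_thirtytwo_of`, `…_neg_sixteen`, `…_neg_fourteen`, Kim–Yamada's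
   Theorems A/B as formalised in the `CappellShanesonClassGroup*` files), so `X_{41,189,73}ᵀ ∼ A₀` is a theorem here
   (`gompfEquiv_transpose_41_189_73`; the conditional form `…_of` is kept for readers who import less).
   Consequently Gompf's conjecture for the traces `70, 73, 75, 76, 77` reduces to five classes, one per pair, plus
   `(41,189,73)`, PROVIDED Gompf equivalence to `A₀` passes to transposes — which we state as an open question, not
   as a fact: is `X ∼ A₀ ⇒ Xᵀ ∼ A₀` for Cappell–Shaneson matrices `X`?  (`A₀ᵀ ∼ A₀` holds, `A₀` being standard with
   `a = d = 1`.)  Nothing here decides any of the eleven classes.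

References: M. H. Kim, S. Yamada, *Ideal classes and Cappell–Shaneson homotopy 4-spheres*, Kyungpook Math. J. 63
(2023) 373–411, arXiv:1707.03860 [KimYamada2023], Def. 2.5, Prop. 2.10, Rem. 2.21; K. Iwaki, *Infinite families of
standard Cappell-Shaneson homotopy 4-spheres*, Topology Appl. 366 (2025) 109293, arXiv:2404.05096 [Iwaki2025], §5.3
(the open classes); O. Taussky, Illinois J. Math. 1 (1957) 108–113 [Taussky1957]; R. E. Gompf, Algebr. Geom. Topol.
10 (2010) 1665–1681, arXiv:0908.1914 [Gompf2010CappellShaneson], §3.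
Companion computations (exact integer arithmetic, independent of Lean): bundle `numerics/` and the cell's
`anom/transpose_pairs.py`, `anom/results/transpose_pairs.json`.
-/

-- D-0017 layout `Summit.<Summit>.<Problem>…` repeats the summit name for single-problem summits (gate passes -Dweak.linter.dupNamespace=false under Summits/)
set_option linter.dupNamespace false

open Literature.Topology.FourManifolds
open scoped MatrixGroups

namespace Summit.SmoothPoincare4.SmoothPoincare4.Theorems.CappellShanesonTranspose

/-! ### 1. The transposition identity `X_{c,d,n}ᵀ P = P X_{c,sa,n}` -/

/-- **The transposition identity at the level of entries**: for all integers `a b c d m` and `s` with `s s = 1`,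
`(!![0, a, b; 0, c, d; 1, 0, m])ᵀ * P = P * !![0, s d, b; 0, c, s a; 1, 0, m]` with `P = !![0, 0, 1; 0, s, 0; 1, 0, m]`.
No relation among `a, b, c, d` is needed. -/
theorem transpose_mul_eq_mul (a b c d m s : ℤ) (hs : s * s = 1) :
    Matrix.transpose (!![0, a, b; 0, c, d; 1, 0, m] : Matrix (Fin 3) (Fin 3) ℤ) * !![0, 0, 1; 0, s, 0; 1, 0, m]
      = !![0, 0, 1; 0, s, 0; 1, 0, m] * !![0, s * d, b; 0, c, s * a; 1, 0, m] := by
  ext i j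
  fin_cases i <;> fin_cases j <;>
    simp [Matrix.mul_apply, Fin.sum_univ_three, Matrix.transpose_apply]
  all_goals first
    | rfl
    | ring1
    | (linear_combination (-a) * hs)

/-- `det !![0, 0, 1; 0, s, 0; 1, 0, m] = -s` (so the intertwiner is unimodular when `s = ±1`). -/
theorem det_transposeIntertwiner (s m : ℤ) :
    (!![0, 0, 1; 0, s, 0; 1, 0, m] : Matrix (Fin 3) (Fin 3) ℤ).det = -s := by
  simp [Matrix.det_fin_three]

variable {c d n : ℤ}

/-- The entry `a = csEntryA c d n` of a standard matrix is non-zero: `a d = -fₙ(c)` and `fₙ(c)` is odd. -/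
theorem csEntryA_ne_zero (h : d ∣ (csPoly n).eval c) : csEntryA c d n ≠ 0 := by
  intro h0
  have hA := csEntryA_mul h
  rw [h0, zero_mul] at hA
  obtain ⟨k, hk⟩ := odd_eval_csPoly n c
  omega

/-- `fₙ(c) = (s a) · (-(s d))` for `a = csEntryA c d n` and `s s = 1` (from `a d = -fₙ(c)`). -/
theorem eval_csPoly_eq_mul_partner (h : d ∣ (csPoly n).eval c) {s : ℤ} (hs : s * s = 1) :
    (csPoly n).eval c = (s * csEntryA c d n) * (-(s * d)) := by
  have hA := csEntryA_mul h
  linear_combination (s * s) * hA - ((csPoly n).eval c) * hs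

/-- The partner triple is Cappell–Shaneson: `s a ∣ fₙ(c)`. -/
theorem partner_dvd (h : d ∣ (csPoly n).eval c) {s : ℤ} (hs : s * s = 1) :
    s * csEntryA c d n ∣ (csPoly n).eval c :=
  Dvd.intro _ (eval_csPoly_eq_mul_partner h hs).symm

/-- The `a`-entry of the partner: `csEntryA c (s a) n = s d`. -/
theorem csEntryA_partner (h : d ∣ (csPoly n).eval c) {s : ℤ} (hs : s * s = 1) :
    csEntryA c (s * csEntryA c d n) n = s * d := by
  have hs0 : s ≠ 0 := by
    rintro rfl
    simp at hs
  have hne : s * csEntryA c d n ≠ 0 := mul_ne_zero hs0 (csEntryA_ne_zero h)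
  have key : ∀ e : ℤ, e ≠ 0 → (csPoly n).eval c = e * (-(s * d)) → csEntryA c e n = s * d := by
    intro e he hfe
    unfold csEntryA
    rw [hfe, Int.mul_ediv_cancel_left _ he]
    ring
  exact key _ hne (eval_csPoly_eq_mul_partner h hs)

/-- **The transpose of a standard matrix is similar to the complementary standard matrix**:
`X_{c,sa,n} ∼ X_{c,d,n}ᵀ` in `SL(3, ℤ)` for `s = ±1` (take `s = sign a` to get the standard triple
`(c, |a|, n)`), via the unimodular intertwiner `P = !![0, 0, 1; 0, s, 0; 1, 0, n - c]`, `P X_{c,sa,n} = X_{c,d,n}ᵀ P`. -/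
theorem isConj_transpose_standardCSMatrix (h : d ∣ (csPoly n).eval c) (s : ℤ) (hs : s * s = 1)
    (h' : s * csEntryA c d n ∣ (csPoly n).eval c) :
    IsConj (standardCSMatrix c (s * csEntryA c d n) n h')
      (Matrix.SpecialLinearGroup.transpose (standardCSMatrix c d n h)) := by
  refine (isConj_iff_exists_isUnit_det _ _).2 ⟨!![0, 0, 1; 0, s, 0; 1, 0, n - c], ?_, ?_⟩
  · rw [det_transposeIntertwiner]
    exact isUnit_iff_exists_inv.mpr ⟨-s, by linear_combination hs⟩
  · simp only [Matrix.SpecialLinearGroup.coe_transpose, coe_standardCSMatrix, csEntryA_partner h hs]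
    exact (transpose_mul_eq_mul _ _ _ _ _ _ hs).symm

/-- The same with the divisibility witness supplied: `∃ h', X_{c,sa,n} ∼ X_{c,d,n}ᵀ`. -/
theorem exists_isConj_transpose_standardCSMatrix (h : d ∣ (csPoly n).eval c) (s : ℤ) (hs : s * s = 1) :
    ∃ h' : s * csEntryA c d n ∣ (csPoly n).eval c,
      IsConj (standardCSMatrix c (s * csEntryA c d n) n h')
        (Matrix.SpecialLinearGroup.transpose (standardCSMatrix c d n h)) :=
  ⟨partner_dvd h hs, isConj_transpose_standardCSMatrix h s hs _⟩

/-! ### 2. The five transpose pairs among the eleven open classes, and the transpose of `(41,189,73)` -/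

/-- **`(37,155,70) ∼ (104,141,70)ᵀ`**: `W X_{37,155,70} = X_{104,141,70}ᵀ W` for the unimodular
`W = !![-4, -37, -287; -312, -2749, -21812; -287, -2469, -19814]` (`det W = 1`), checked by `decide`. -/
theorem isConj_transpose_104_141_37_155 (h : (141 : ℤ) ∣ (csPoly 70).eval 104)
    (h' : (155 : ℤ) ∣ (csPoly 70).eval 37) :
    IsConj (standardCSMatrix 37 155 70 h')
      (Matrix.SpecialLinearGroup.transpose (standardCSMatrix 104 141 70 h)) :=
  (isConj_iff_exists_isUnit_det _ _).2
    ⟨!![-4, -37, -287; -312, -2749, -21812; -287, -2469, -19814], Int.isUnit_iff.mpr (by decide), by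
      simp only [Matrix.SpecialLinearGroup.coe_transpose, coe_standardCSMatrix, csEntryA, eval_csPoly]
      decide⟩

/-- `(104,141,70)` and `(37,155,70)` are Cappell–Shaneson triples. -/
theorem dvd_104_141_70_and : (141 : ℤ) ∣ (csPoly 70).eval 104 ∧ (155 : ℤ) ∣ (csPoly 70).eval 37 := by
  norm_num [eval_csPoly]

/-- **`(23,171,73) ∼ (23,145,73)ᵀ`**: `W X_{23,171,73} = X_{23,145,73}ᵀ W` for the unimodular
`W = !![0, 0, 1; 0, 1, 0; 1, 0, 50]` (`det W = -1`), checked by `decide`. -/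
theorem isConj_transpose_23_145_23_171 (h : (145 : ℤ) ∣ (csPoly 73).eval 23)
    (h' : (171 : ℤ) ∣ (csPoly 73).eval 23) :
    IsConj (standardCSMatrix 23 171 73 h')
      (Matrix.SpecialLinearGroup.transpose (standardCSMatrix 23 145 73 h)) :=
  (isConj_iff_exists_isUnit_det _ _).2
    ⟨!![0, 0, 1; 0, 1, 0; 1, 0, 50], Int.isUnit_iff.mpr (by decide), by
      simp only [Matrix.SpecialLinearGroup.coe_transpose, coe_standardCSMatrix, csEntryA, eval_csPoly]
      decide⟩

/-- `(23,145,73)` and `(23,171,73)` are Cappell–Shaneson triples. -/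
theorem dvd_23_145_73_and : (145 : ℤ) ∣ (csPoly 73).eval 23 ∧ (171 : ℤ) ∣ (csPoly 73).eval 23 := by
  norm_num [eval_csPoly]

/-- **`(101,163,75) ∼ (31,197,75)ᵀ`**: `W X_{101,163,75} = X_{31,197,75}ᵀ W` for the unimodular
`W = !![13, 808, 966; 62, 3825, 4561; 966, 59859, 71488]` (`det W = 1`), checked by `decide`. -/
theorem isConj_transpose_31_197_101_163 (h : (197 : ℤ) ∣ (csPoly 75).eval 31)
    (h' : (163 : ℤ) ∣ (csPoly 75).eval 101) :
    IsConj (standardCSMatrix 101 163 75 h')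
      (Matrix.SpecialLinearGroup.transpose (standardCSMatrix 31 197 75 h)) :=
  (isConj_iff_exists_isUnit_det _ _).2
    ⟨!![13, 808, 966; 62, 3825, 4561; 966, 59859, 71488], Int.isUnit_iff.mpr (by decide), by
      simp only [Matrix.SpecialLinearGroup.coe_transpose, coe_standardCSMatrix, csEntryA, eval_csPoly]
      decide⟩

/-- `(31,197,75)` and `(101,163,75)` are Cappell–Shaneson triples. -/
theorem dvd_31_197_75_and : (197 : ℤ) ∣ (csPoly 75).eval 31 ∧ (163 : ℤ) ∣ (csPoly 75).eval 101 := by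
  norm_num [eval_csPoly]

/-- **`(116,141,76) ∼ (98,153,76)ᵀ`**: `W X_{116,141,76} = X_{98,153,76}ᵀ W` for the unimodular
`W = !![-11, -1044, -829; -686, -64951, -51509; -829, -78435, -62179]` (`det W = -1`), checked by `decide`. -/
theorem isConj_transpose_98_153_116_141 (h : (153 : ℤ) ∣ (csPoly 76).eval 98)
    (h' : (141 : ℤ) ∣ (csPoly 76).eval 116) :
    IsConj (standardCSMatrix 116 141 76 h')
      (Matrix.SpecialLinearGroup.transpose (standardCSMatrix 98 153 76 h)) :=
  (isConj_iff_exists_isUnit_det _ _).2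
    ⟨!![-11, -1044, -829; -686, -64951, -51509; -829, -78435, -62179], Int.isUnit_iff.mpr (by decide), by
      simp only [Matrix.SpecialLinearGroup.coe_transpose, coe_standardCSMatrix, csEntryA, eval_csPoly]
      decide⟩

/-- `(98,153,76)` and `(116,141,76)` are Cappell–Shaneson triples. -/
theorem dvd_98_153_76_and : (153 : ℤ) ∣ (csPoly 76).eval 98 ∧ (141 : ℤ) ∣ (csPoly 76).eval 116 := by
  norm_num [eval_csPoly]

/-- **`(34,145,77) ∼ (61,253,77)ᵀ`**: `W X_{34,145,77} = X_{61,253,77}ᵀ W` for the unimodular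
`W = !![4, 34, 317; 61, 461, 4589; 317, 2456, 24105]` (`det W = -1`), checked by `decide`. -/
theorem isConj_transpose_61_253_34_145 (h : (253 : ℤ) ∣ (csPoly 77).eval 61)
    (h' : (145 : ℤ) ∣ (csPoly 77).eval 34) :
    IsConj (standardCSMatrix 34 145 77 h')
      (Matrix.SpecialLinearGroup.transpose (standardCSMatrix 61 253 77 h)) :=
  (isConj_iff_exists_isUnit_det _ _).2
    ⟨!![4, 34, 317; 61, 461, 4589; 317, 2456, 24105], Int.isUnit_iff.mpr (by decide), by
      simp only [Matrix.SpecialLinearGroup.coe_transpose, coe_standardCSMatrix, csEntryA, eval_csPoly]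
      decide⟩

/-- `(61,253,77)` and `(34,145,77)` are Cappell–Shaneson triples. -/
theorem dvd_61_253_77_and : (253 : ℤ) ∣ (csPoly 77).eval 61 ∧ (145 : ℤ) ∣ (csPoly 77).eval 34 := by
  norm_num [eval_csPoly]

/-- **`(83,105,73) ∼ (41,189,73)ᵀ`**: `W X_{83,105,73} = X_{41,189,73}ᵀ W` for the unimodular
`W = !![2, 132, 147; 18, 1151, 1276; 147, 9530, 10586]` (`det W = 1`), checked by `decide`. -/
theorem isConj_transpose_41_189_83_105 (h : (189 : ℤ) ∣ (csPoly 73).eval 41)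
    (h' : (105 : ℤ) ∣ (csPoly 73).eval 83) :
    IsConj (standardCSMatrix 83 105 73 h')
      (Matrix.SpecialLinearGroup.transpose (standardCSMatrix 41 189 73 h)) :=
  (isConj_iff_exists_isUnit_det _ _).2
    ⟨!![2, 132, 147; 18, 1151, 1276; 147, 9530, 10586], Int.isUnit_iff.mpr (by decide), by
      simp only [Matrix.SpecialLinearGroup.coe_transpose, coe_standardCSMatrix, csEntryA, eval_csPoly]
      decide⟩

/-- `(41,189,73)` and `(83,105,73)` are Cappell–Shaneson triples. -/
theorem dvd_41_189_73_and : (189 : ℤ) ∣ (csPoly 73).eval 41 ∧ (105 : ℤ) ∣ (csPoly 73).eval 83 := by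
  norm_num [eval_csPoly]

/-- **The transpose of the open class `(41,189,73)` is settled by Kim–Yamada's range**: `(83,105,73) ∼_G (83,105,-32)`
(`73 - 105 = -32`), so `X_{41,189,73}ᵀ ∼ A₀` granted Gompf's conjecture for the trace `-32` (Kim–Yamada 2023, Thm. B;
in the tree `GompfConjectureForTrace (-32)` is available as `gompfConjectureForTrace_neg_thirtytwo_of` under its
class-group hypothesis). -/
theorem gompfEquiv_transpose_41_189_73_of (h32 : GompfConjectureForTrace (-32))
    (h : (189 : ℤ) ∣ (csPoly 73).eval 41) :
    GompfEquiv (Matrix.SpecialLinearGroup.transpose (standardCSMatrix 41 189 73 h)) akbulutKirbyMatrix := by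
  have h' : (105 : ℤ) ∣ (csPoly 73).eval 83 := by norm_num [eval_csPoly]
  obtain ⟨h1, e1⟩ := gompfEquiv_standardCSMatrix_of_add_mul_eq (n' := (-32)) h' (-1) (by norm_num)
  exact ((GompfEquiv.of_isConj (isConj_transpose_41_189_83_105 h h')).symm.trans e1).trans
    (h32.standardCSMatrix h1)

/-- **`(83,105,73) ∼ A₀` unconditionally in the tree**: one trace move to `-32 = 73 - 105`, a trace the tree settles
(`gompfConjectureForTrace_neg_thirtytwo_of` from the theorems for the traces `-16` and `-14`, via `37 = 5 - (-32)` and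
Kim–Yamada's Theorem A). -/
theorem gompfEquiv_akbulutKirbyMatrix_83_105_73 (h' : (105 : ℤ) ∣ (csPoly 73).eval 83) :
    GompfEquiv (standardCSMatrix 83 105 73 h') akbulutKirbyMatrix := by
  obtain ⟨h1, e1⟩ := gompfEquiv_standardCSMatrix_of_add_mul_eq (n' := (-32)) h' (-1) (by norm_num)
  exact e1.trans ((gompfConjectureForTrace_neg_thirtytwo_of gompfConjectureForTrace_neg_sixteen
    gompfConjectureForTrace_neg_fourteen).standardCSMatrix h1)

/-- **The transpose of the open class `(41,189,73)` is Gompf equivalent to `A₀` — unconditionally**: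
`X_{41,189,73}ᵀ ∼ X_{83,105,73} ∼_G X_{83,105,-32} ∼ A₀`, all three steps theorems of the tree.  (Whether
`X_{41,189,73}` itself is Gompf equivalent to `A₀` remains open: that is one of the eleven undecided classes.) -/
theorem gompfEquiv_transpose_41_189_73 (h : (189 : ℤ) ∣ (csPoly 73).eval 41) :
    GompfEquiv (Matrix.SpecialLinearGroup.transpose (standardCSMatrix 41 189 73 h)) akbulutKirbyMatrix :=
  gompfEquiv_transpose_41_189_73_of
    (gompfConjectureForTrace_neg_thirtytwo_of gompfConjectureForTrace_neg_sixteen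
      gompfConjectureForTrace_neg_fourteen) h

end Summit.SmoothPoincare4.SmoothPoincare4.Theorems.CappellShanesonTranspose
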